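import Summits.ABC.IUTFork.Joshi.PrototypeExponentModel
import Summits.ABC.IUTFork.Joshi.MochizukiAnsatzLocal
import HarnessLib

/-!
# A JOINT kernel model of the [J-IIp] §6 hypotheses over E-t3's signature: a BIJECTIVE point-Frobenius AND E-t2's
# `EtaPtTeich` («`η_{K_{y_a}}([a]) = p`», Lem. 6.10.1) at ONE `PrototypeDatum` (part 1: the model; part 2 = `…JointModelSupply`)

Test-side support file of the abc-iut cell, block E «type Joshi's construction, test vs S» (rung LADDER-ABC:A2.E; seat
abc-iut-E-t57, gen 2, the [J-IIp] MODEL / NV seat of plan/E/ASSIGNMENTS.md §2d). Carriers and hypotheses BY NAME, nothing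
restated: E-t3's `PeriodRingDatum` / `PrototypeDatum` (`Joshi/ThetaValuesLocus`, `Joshi/PrimitiveAnsatz`), E-t2's
`PeriodRingDatum.EtaPtTeich` (`Joshi/MochizukiAnsatzLocal`; source arXiv:2303.01662v3 Lem. 6.10.1, p. 18 l. 11–15, UNREFEREED, bib
`Joshi2023ATS2Local`), the exponent model's toolkit `ExpModel.expQ` / `ExpModel.sc` / `ExpModel.lift` (`Joshi/PrototypeExponentModel`,
p434861). NOTHING here is a claim about Joshi's or Mochizuki's mathematics; no side is taken on [IUTchIII] Cor. 3.12 or on any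
author; a model exhibits satisfiability of TYPED hypotheses, nothing more.

WHY (census of `Joshi/PrototypeExponentModelEtaPt.lean`, p439098 — referred to by name, not imported): of the two named [J-IIp] §6
hypotheses {`EtaPtTeich`, the `ϕ^{−1}`-clause of Prop. 6.6.1 = E-t7's `PrimAnsatzFrobeniusInvariant` in `↔` form}, each model of
record carries exactly ONE — E-t2's transposed O1 model p437626 (`EtaPtTeich` ✓, `y ↦ y^p` on `Q̄_p` not injective, p436434) and the
exponent model (`ϕ` bijective ✓, `ExpModel.not_etaPtTeich`: its point map factors through `|−|_F`, which `EtaPtTeich` forbids by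
`PeriodRingDatum.exists_absF_eq_and_pt_ne_of_etaPtTeich`). THIS FILE builds one model with BOTH.

THE MODEL (logical, not arithmetic-faithful; ambient field `Q̄_p = PadicAlgCl p` as in E-t3's models). POINTS `Y := Q̄_p/∼`,
`a ∼ b :⇔ ∃ n, a^{pⁿ} = b^{pⁿ}` (classes `a·μ_{p^∞}` off `0` — the coarsest quotient on which `a ↦ a^p` descends to an INJECTION; a
bijection since `Q̄_p` has `p`-th roots); `pt := [−]`, `ϕ([a]) := [a^p]`. SCALES: `‖·‖` is constant on classes, so the exponent
`e([a]) := ExpModel.expQ a` descends; `K_y := Q̄_p` with `‖·‖^{sc e(y)}`, `B := Y → Q̄_p`, `η_y` = evaluation, `φ := id`, Galois trivial,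
`T_y := {0}`, `|b|_ρ := ‖b([p])‖`. TEICHMÜLLER FIELD `x ↦ [x](y)` (the one new idea): for `y` with admissible representative `a₀ := y.out`,
on the sphere `S = {‖x‖ = ‖a₀‖} ⊇ y` — which (A1) `absK_eta_teich` / (A2) `exists_teich_lift` force to map ONTO `{‖ξ‖ = ‖p‖}` — a
HILBERT-HOTEL modification of `g(x) := x·p/a₀` along a non-torsion unit `w` (`2`, or `3` if `p = 2`): the class `y` (level `0`) ↦ `p`
(this IS `EtaPtTeich`), the shifted classes `y·w^{−m}`, `m ≥ 1` (level `m`) ↦ `g(x·w)`, the rest of `S` ↦ `g(x)`; off `S`, `ExpModel.lift`.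
Still onto (`hotel_surjective`: the value `g(x′)` lost at level `m` is taken at the level-`(m+1)` point `x′·w^{−1}`, never at level `0`
since `w` is no root of unity). RESULTS: `frobY_bijective`, `exists_pth_root`, **`etaPtTeich : (prototypeDatum p).EtaPtTeich`**,
`etaPtTeich_and_frobY_bijective`; E-t7's four inputs at the glued adelic datum follow in part 2. [folklore]
-/

noncomputable section

namespace Summit.ABC.IUTFork.Joshi.JointModel

variable (p : ℕ) [hp : Fact p.Prime]

/-! ## 0. `p`-adic bookkeeping: the norm of `p`, a non-torsion unit `w` -/

/-- In the exponent model the point `e(a)` depends only on `‖a‖` — this is `ExpModel.expQ_eq_of_norm_eq` of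
`Joshi/PrototypeExponentModelEtaPt.lean` (p439098), re-derived `private`ly so that this file imports only long-built modules. [folklore] -/
private theorem expQ_eq_of_norm_eq' {x a : PadicAlgCl p} (h : ‖x‖ = ‖a‖) : ExpModel.expQ p x = ExpModel.expQ p a := by
  unfold ExpModel.expQ
  rw [h]
  split_ifs with hc
  · have ha : a ≠ 0 := norm_pos_iff.1 hc.1
    have hx : x ≠ 0 := norm_pos_iff.1 (h ▸ hc.1)
    rw [ExpModel.normExp_eq_of_norm_eq p hx (h.trans (Model.norm_eq_rpow_normExp p ha))]
  · rfl

/-- `0 < ‖p‖ < 1` in `Q̄_p` (= `Literature.NumberTheory.GaloisRepresentations.PadicAlgCl.norm_natCast_prime_pos_lt_one`, whose heavy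
module is not imported into this model file; `private` copy read off the exponent model's datum). [folklore] -/
private theorem norm_p_pos_lt_one : 0 < ‖(p : PadicAlgCl p)‖ ∧ ‖(p : PadicAlgCl p)‖ < 1 := by
  have := (ExpModel.periodRingDatum p).abs0_p
  rwa [show (ExpModel.periodRingDatum p).abs0 = Model.absOne p from rfl, Model.absOne_apply] at this

/-- `(p : Q̄_p) ≠ 0` (= `Literature.NumberTheory.Transcendental.IwasawaLog.natCast_prime_ne_zero`, not imported; `private`). [folklore] -/
private theorem p_ne_zero : (p : PadicAlgCl p) ≠ 0 := norm_pos_iff.1 (norm_p_pos_lt_one p).1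

/-- The auxiliary unit: `2`, or `3` when `p = 2` (a natural number prime to `p` and `> 1`). [folklore] -/
def wNat : ℕ := if p = 2 then 3 else 2

omit hp in
/-- `1 < wNat`. [folklore] -/
theorem one_lt_wNat : 1 < wNat p := by
  unfold wNat; split_ifs <;> norm_num

/-- `p` is prime to `wNat`. [folklore] -/
theorem coprime_wNat : p.Coprime (wNat p) := by
  unfold wNat
  split_ifs with h
  · subst h; decide
  · exact (Nat.coprime_primes hp.out Nat.prime_two).2 h

/-- The unit `w := wNat ∈ Q̄_p`. [folklore] -/
def w : PadicAlgCl p := (wNat p : PadicAlgCl p)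

/-- `‖w‖ = 1` (`p ∤ wNat`; cf. `PadicAlgCl.norm_natCast_eq_one_of_not_dvd'` in `Literature/…/PadicCharacterNthRoot`, not imported
to keep this model file light). [folklore] -/
theorem norm_w : ‖w p‖ = 1 := by
  rw [w, ← map_natCast (algebraMap ℚ_[p] (PadicAlgCl p)), PadicAlgCl.norm_extends, Padic.norm_natCast_eq_one_iff]
  exact coprime_wNat p

/-- `w ≠ 0`. [folklore] -/
theorem w_ne_zero : w p ≠ 0 := norm_pos_iff.1 (by rw [norm_w]; exact one_pos)

/-- **`w` is not a root of unity**: `w^N = 1 ⟹ N = 0` (`wNat^N = 1` in `ℕ` by injectivity of `ℕ → Q̄_p`). [folklore] -/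
theorem eq_zero_of_w_pow_eq_one {N : ℕ} (h : w p ^ N = 1) : N = 0 := by
  have h' : ((wNat p ^ N : ℕ) : PadicAlgCl p) = ((1 : ℕ) : PadicAlgCl p) := by rw [Nat.cast_pow, Nat.cast_one]; exact h
  rcases Nat.pow_eq_one.1 (Nat.cast_injective h') with h1 | h1
  · exact absurd h1 (one_lt_wNat p).ne'
  · exact h1

/-! ## 1. The point set: classes of `Q̄_p` modulo `a ∼ b :⇔ ∃ n, a^{pⁿ} = b^{pⁿ}`; the bijective Frobenius; the exponent -/

/-- The relation `a ∼ b :⇔ ∃ n, a^{pⁿ} = b^{pⁿ}` (off `0`: `a/b` is a `p`-power root of unity). [folklore] -/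
def Rel (a b : PadicAlgCl p) : Prop := ∃ n : ℕ, a ^ p ^ n = b ^ p ^ n

/-- `∼` is reflexive. [folklore] -/
theorem rel_refl (a : PadicAlgCl p) : Rel p a a := ⟨0, rfl⟩

/-- `∼` is symmetric. [folklore] -/
theorem rel_symm {a b : PadicAlgCl p} (h : Rel p a b) : Rel p b a := by
  obtain ⟨n, h⟩ := h; exact ⟨n, h.symm⟩

/-- `∼` is transitive (raise both identities to a common `p`-power). [folklore] -/
theorem rel_trans {a b c : PadicAlgCl p} (h₁ : Rel p a b) (h₂ : Rel p b c) : Rel p a c := by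
  obtain ⟨n, h₁⟩ := h₁
  obtain ⟨m, h₂⟩ := h₂
  refine ⟨n + m, ?_⟩
  calc a ^ p ^ (n + m) = (a ^ p ^ n) ^ p ^ m := by rw [pow_add, pow_mul]
    _ = (b ^ p ^ n) ^ p ^ m := by rw [h₁]
    _ = (b ^ p ^ m) ^ p ^ n := by rw [← pow_mul, ← pow_mul, mul_comm]
    _ = (c ^ p ^ m) ^ p ^ n := by rw [h₂]
    _ = c ^ p ^ (n + m) := by rw [← pow_mul, pow_add, mul_comm]

/-- `a ∼ b ⟹ a^p ∼ b^p`. [folklore] -/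
theorem rel_pow_p {a b : PadicAlgCl p} (h : Rel p a b) : Rel p (a ^ p) (b ^ p) := by
  obtain ⟨n, h⟩ := h
  exact ⟨n, by rw [← pow_mul, ← pow_mul, mul_comm, pow_mul, pow_mul, h]⟩

/-- `a^p ∼ b^p ⟹ a ∼ b` (one more `p`-power). [folklore] -/
theorem rel_of_rel_pow_p {a b : PadicAlgCl p} (h : Rel p (a ^ p) (b ^ p)) : Rel p a b := by
  obtain ⟨n, h⟩ := h
  exact ⟨n + 1, by rw [pow_succ', pow_mul, pow_mul, h]⟩

/-- Related elements have the same norm. [folklore] -/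
theorem norm_eq_of_rel {a b : PadicAlgCl p} (h : Rel p a b) : ‖a‖ = ‖b‖ := by
  obtain ⟨n, h⟩ := h
  have h' : ‖a‖ ^ p ^ n = ‖b‖ ^ p ^ n := by rw [← norm_pow, ← norm_pow, h]
  exact (pow_left_inj₀ (norm_nonneg a) (norm_nonneg b) (pow_ne_zero n hp.out.ne_zero)).1 h'

/-- **No nonzero element is related to a proper `w`-power shift of itself** (`w` is not a root of unity). [folklore] -/
theorem not_rel_mul_w_pow {x : PadicAlgCl p} (hx : x ≠ 0) {k : ℕ} (hk : k ≠ 0) : ¬ Rel p x (x * w p ^ k) := by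
  rintro ⟨n, h⟩
  rw [mul_pow, ← pow_mul] at h
  have h1 : w p ^ (k * p ^ n) = 1 := (mul_eq_left₀ (pow_ne_zero _ hx)).1 h.symm
  rcases Nat.mul_eq_zero.1 (eq_zero_of_w_pow_eq_one p h1) with h2 | h2
  · exact hk h2
  · exact pow_ne_zero n hp.out.ne_zero h2

/-- The setoid of `∼`. [folklore] -/
def ptSetoid : Setoid (PadicAlgCl p) := ⟨Rel p, ⟨rel_refl p, rel_symm p, rel_trans p⟩⟩

/-- **The point set** `Y := Q̄_p / ∼`. [folklore] -/
abbrev Pt : Type := Quotient (ptSetoid p)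

/-- The point of a parameter, `[a]`. [folklore] -/
abbrev mk (a : PadicAlgCl p) : Pt p := Quotient.mk (ptSetoid p) a

/-- `[a] = [b] ↔ a ∼ b`. [folklore] -/
theorem mk_eq_mk_iff {a b : PadicAlgCl p} : mk p a = mk p b ↔ Rel p a b :=
  ⟨fun h => Quotient.exact h, fun h => Quotient.sound h⟩

/-- The chosen representative of `[a]` is related to `a`. [folklore] -/
theorem rel_out_mk (a : PadicAlgCl p) : Rel p (mk p a).out a := @Quotient.mk_out _ (ptSetoid p) a

/-- **The point-Frobenius** `ϕ([a]) := [a^p]`. [folklore] -/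
def frobPt : Pt p → Pt p :=
  Quotient.lift (fun a => mk p (a ^ p)) fun _ _ h => (mk_eq_mk_iff p).2 (rel_pow_p p h)

/-- `ϕ([a]) = [a^p]`. [folklore] -/
theorem frobPt_mk (a : PadicAlgCl p) : frobPt p (mk p a) = mk p (a ^ p) := rfl

/-- **`ϕ` is a BIJECTION** of the point set (injective: one more `p`-power; surjective: `p`-th roots exist in `Q̄_p`). [folklore] -/
theorem frobPt_bijective : Function.Bijective (frobPt p) := by
  refine ⟨fun y₁ y₂ h => ?_, fun y => ?_⟩
  · induction y₁ using Quotient.inductionOn with | h a => ?_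
    induction y₂ using Quotient.inductionOn with | h b => ?_
    change mk p (a ^ p) = mk p (b ^ p) at h
    exact (mk_eq_mk_iff p).2 (rel_of_rel_pow_p p ((mk_eq_mk_iff p).1 h))
  · induction y using Quotient.inductionOn with | h b => ?_
    obtain ⟨a, ha⟩ := IsAlgClosed.exists_pow_nat_eq b hp.out.pos
    exact ⟨mk p a, by rw [frobPt_mk, ha]⟩

/-- **The valuation exponent of a point**: `e(y) := ExpModel.expQ (y.out)` (`‖·‖`, hence `expQ`, is constant on classes). [folklore] -/
def e (y : Pt p) : ℚ := ExpModel.expQ p y.out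

/-- `e([a]) = expQ a`. [folklore] -/
theorem e_mk (a : PadicAlgCl p) : e p (mk p a) = ExpModel.expQ p a :=
  expQ_eq_of_norm_eq' p (norm_eq_of_rel p (rel_out_mk p a))

/-- Admissibility of a parameter: `0 < ‖a‖ < 1`. [folklore] -/
def Adm (a : PadicAlgCl p) : Prop := 0 < ‖a‖ ∧ ‖a‖ < 1

/-- For admissible `a`: `‖p‖^{sc e} = ‖a‖` with `e = expQ a`. [folklore] -/
theorem norm_p_rpow_sc {a : PadicAlgCl p} (ha : Adm p a) :
    ‖(p : PadicAlgCl p)‖ ^ ExpModel.sc (ExpModel.expQ p a) = ‖a‖ := by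
  rw [ExpModel.sc_of_pos (ExpModel.expQ_pos p ha.1 ha.2), ExpModel.norm_p_rpow_expQ p ha.1 ha.2]

/-- For admissible `a`: `‖a‖^{1/sc e} = ‖p‖`. [folklore] -/
theorem norm_rpow_inv_sc {a : PadicAlgCl p} (ha : Adm p a) :
    ‖a‖ ^ (1 / ExpModel.sc (ExpModel.expQ p a)) = ‖(p : PadicAlgCl p)‖ := by
  rw [← norm_p_rpow_sc p ha, ← Real.rpow_mul (norm_nonneg _), mul_one_div_cancel (ExpModel.sc_pos _).ne', Real.rpow_one]

/-! ## 2. The Hilbert-hotel Teichmüller field on the sphere of an admissible representative -/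

section Hotel

open scoped Classical

/-- The linear comparison map of the sphere `{‖x‖ = ‖a₀‖}` onto `{‖ξ‖ = ‖p‖}`: `g(x) := x·p/a₀`. [folklore] -/
def g (a₀ x : PadicAlgCl p) : PadicAlgCl p := x * ((p : PadicAlgCl p) / a₀)

/-- `‖g(x)‖ = ‖p‖` on the sphere. [folklore] -/
theorem norm_g {a₀ x : PadicAlgCl p} (ha : a₀ ≠ 0) (hx : ‖x‖ = ‖a₀‖) : ‖g p a₀ x‖ = ‖(p : PadicAlgCl p)‖ := by
  rw [g, norm_mul, norm_div, hx, ← mul_div_assoc, mul_div_cancel_left₀ _ (norm_ne_zero_iff.2 ha)]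

/-- **The hotel map** at the representative `a₀`: `x ↦ p` on the class of `a₀` (level `0`), `x ↦ g(x·w)` on the shifted classes
`a₀·μ_{p^∞}·w^{−m}`, `m ≥ 1` (level `m`), `x ↦ g(x)` elsewhere. [folklore] -/
def hotel (a₀ x : PadicAlgCl p) : PadicAlgCl p :=
  if h : ∃ m : ℕ, Rel p (x * w p ^ m) a₀ then (if Nat.find h = 0 then (p : PadicAlgCl p) else g p a₀ (x * w p))
  else g p a₀ x

/-- On the class of `a₀` the hotel map is the constant `p`. [folklore] -/
theorem hotel_of_rel {a₀ x : PadicAlgCl p} (hx : Rel p x a₀) : hotel p a₀ x = p := by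
  have h : ∃ m : ℕ, Rel p (x * w p ^ m) a₀ := ⟨0, by rw [pow_zero, mul_one]; exact hx⟩
  rw [hotel, dif_pos h, if_pos ((Nat.find_eq_zero h).2 (by rw [pow_zero, mul_one]; exact hx))]

/-- Every value of the hotel map on the sphere `{‖x‖ = ‖a₀‖}` has norm `‖p‖`. [folklore] -/
theorem norm_hotel {a₀ x : PadicAlgCl p} (ha : a₀ ≠ 0) (hx : ‖x‖ = ‖a₀‖) : ‖hotel p a₀ x‖ = ‖(p : PadicAlgCl p)‖ := by
  rw [hotel]
  split_ifs
  · rfl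
  · exact norm_g p ha (by rw [norm_mul, norm_w, mul_one, hx])
  · exact norm_g p ha hx

/-- **The hotel map is ONTO the sphere `{‖ξ‖ = ‖p‖}` from the sphere `{‖x‖ = ‖a₀‖}`**: for `ξ`, let `x′ := ξ·a₀/p` (`g(x′) = ξ`); if
`x′` is at some level `m`, the point `x′·w^{−1}` is at level `m + 1 ≥ 1` (not `0`: `w` is no root of unity) and is sent to `g(x′) = ξ`;
otherwise `x′` itself is sent to `g(x′) = ξ`. [folklore] -/
theorem hotel_surjective {a₀ : PadicAlgCl p} (ha : a₀ ≠ 0) {ξ : PadicAlgCl p} (hξ : ‖ξ‖ = ‖(p : PadicAlgCl p)‖) :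
    ∃ x : PadicAlgCl p, ‖x‖ = ‖a₀‖ ∧ hotel p a₀ x = ξ := by
  set x' : PadicAlgCl p := ξ * (a₀ / p) with hx'
  have hp0 := p_ne_zero p
  have hgx' : g p a₀ x' = ξ := by
    rw [g, hx']; field_simp
  have hnx' : ‖x'‖ = ‖a₀‖ := by
    rw [hx', norm_mul, norm_div, hξ, ← mul_div_assoc, mul_div_cancel_left₀ _ (norm_ne_zero_iff.2 hp0)]
  by_cases h : ∃ m : ℕ, Rel p (x' * w p ^ m) a₀
  · obtain ⟨m, hm⟩ := h
    refine ⟨x' * (w p)⁻¹, by rw [norm_mul, norm_inv, norm_w, inv_one, mul_one, hnx'], ?_⟩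
    have hxw : x' * (w p)⁻¹ * w p = x' := by rw [inv_mul_cancel_right₀ (w_ne_zero p)]
    have hlev : ∃ m' : ℕ, Rel p (x' * (w p)⁻¹ * w p ^ m') a₀ :=
      ⟨m + 1, by rw [pow_succ', ← mul_assoc, hxw]; exact hm⟩
    have hne : Nat.find hlev ≠ 0 := by
      intro h0
      have h0' : Rel p (x' * (w p)⁻¹) a₀ := by
        have := (Nat.find_eq_zero hlev).1 h0
        rwa [pow_zero, mul_one] at this
      have hx0 : x' * (w p)⁻¹ ≠ 0 := by
        refine mul_ne_zero ?_ (inv_ne_zero (w_ne_zero p))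
        rw [← norm_pos_iff, hnx', norm_pos_iff]; exact ha
      refine not_rel_mul_w_pow p hx0 (Nat.succ_ne_zero m) (rel_trans p h0' (rel_symm p ?_))
      rw [pow_succ', ← mul_assoc, hxw]; exact hm
    rw [hotel, dif_pos hlev, if_neg hne, hxw, hgx']
  · exact ⟨x', hnx', by rw [hotel, dif_neg h, hgx']⟩

end Hotel

/-! ## 3. The Teichmüller field at a point, (A1) and (A2) -/

section Teich

open scoped Classical

/-- **The Teichmüller field** `x ↦ [x](y)`: the hotel map at `a₀ := y.out` on its sphere when `a₀` is admissible, the exponent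
model's `lift` (sphere-wise rescaling, exponent `e(y)`) otherwise. [folklore] -/
def teichAt (y : Pt p) (x : PadicAlgCl p) : PadicAlgCl p :=
  if Adm p y.out ∧ ‖x‖ = ‖y.out‖ then hotel p y.out x else ExpModel.lift p (e p y) x

/-- **(A1)**: `‖[x](y)‖^{sc e(y)} = ‖x‖`. [folklore] -/
theorem norm_teichAt_rpow (y : Pt p) (x : PadicAlgCl p) : ‖teichAt p y x‖ ^ ExpModel.sc (e p y) = ‖x‖ := by
  unfold teichAt
  split_ifs with h
  · rw [norm_hotel p (norm_pos_iff.1 h.1.1) h.2, e, norm_p_rpow_sc p h.1, h.2]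
  · exact ExpModel.norm_lift_rpow p _ x

/-- **(A2), strengthened**: `x ↦ [x](y)` is ONTO `K_y = Q̄_p` (hotel surjectivity on the special sphere, `ExpModel.lift_surjective`
elsewhere — a `lift`-preimage of a `ξ` off the sphere `{‖ξ‖ = ‖p‖}` is automatically off the special sphere). [folklore] -/
theorem teichAt_surjective (y : Pt p) : Function.Surjective (teichAt p y) := by
  intro ξ
  by_cases hA : Adm p y.out
  · by_cases hξ : ‖ξ‖ = ‖(p : PadicAlgCl p)‖
    · obtain ⟨x, hx, hxξ⟩ := hotel_surjective p (norm_pos_iff.1 hA.1) hξ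
      exact ⟨x, by rw [teichAt, if_pos ⟨hA, hx⟩, hxξ]⟩
    · obtain ⟨x, hx⟩ := ExpModel.lift_surjective p (e p y) ξ
      have hxs : ¬ ‖x‖ = ‖y.out‖ := by
        intro hxs
        apply hξ
        rw [← hx, ExpModel.norm_lift, hxs, e, norm_rpow_inv_sc p hA]
      exact ⟨x, by rw [teichAt, if_neg (fun h => hxs h.2), hx]⟩
  · obtain ⟨x, hx⟩ := ExpModel.lift_surjective p (e p y) ξ
    exact ⟨x, by rw [teichAt, if_neg (fun h => hA h.1), hx]⟩

/-- **`EtaPtTeich` by construction**: for admissible `a`, `[a]([a]) = p` (the representative `a₀` of `[a]` is admissible with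
`‖a₀‖ = ‖a‖`, and `a` is at level `0` of the hotel). [folklore] -/
theorem teichAt_mk_self {a : PadicAlgCl p} (ha : Adm p a) : teichAt p (mk p a) a = p := by
  have hrel : Rel p (mk p a).out a := rel_out_mk p a
  have hn : ‖(mk p a).out‖ = ‖a‖ := norm_eq_of_rel p hrel
  have hA : Adm p (mk p a).out := by unfold Adm; rw [hn]; exact ha
  rw [teichAt, if_pos ⟨hA, hn.symm⟩, hotel_of_rel p (rel_symm p hrel)]

end Teich

/-! ## 4. The data of E-t3's signature; bijective `ϕ`, `p`-th roots, `EtaPtTeich` -/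

/-- **The joint-model period-ring datum** over E-t3's signature (dictionary in the module docstring). [folklore] -/
def periodRingDatum :
    PeriodRingDatum (PadicAlgCl p) (Pt p → PadicAlgCl p) (PadicAlgCl p) (Pt p) (fun _ => PadicAlgCl p) Unit where
  p := p
  p_prime := hp.out
  absF := Model.absOne p
  norm _ b := ‖b (mk p (p : PadicAlgCl p))‖
  norm_nonneg _ b := norm_nonneg _
  norm_add_le _ b b' := PadicAlgCl.isNonarchimedean p _ _
  teich x := fun y => teichAt p y x
  norm_teich ρ x _ _ := by
    show ‖teichAt p (mk p (p : PadicAlgCl p)) x‖ = Model.absOne p x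
    have h := norm_teichAt_rpow p (mk p (p : PadicAlgCl p)) x
    rw [e_mk, ExpModel.expQ_p, ExpModel.sc_of_pos one_pos, Rat.cast_one, Real.rpow_one] at h
    rw [Model.absOne_apply, h]
  gal _ := id
  frob := id
  gal_norm_one _ _ h := h
  frob_norm_one _ h := h
  absK y := Model.absPow p (ExpModel.sc (e p y)) (ExpModel.sc_pos _)
  eta y := Pi.evalRingHom (fun _ : Pt p => PadicAlgCl p) y
  absK_eta_teich y x := by
    show ‖teichAt p y x‖ ^ ExpModel.sc (e p y) = ‖x‖ ^ (1 : ℝ)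
    rw [Real.rpow_one]; exact norm_teichAt_rpow p y x
  exists_teich_lift y ξ _ := teichAt_surjective p y ξ
  T _ := {0}
  zero_mem_T _ := rfl
  eta_T y τ hτ := by rw [Set.mem_singleton_iff.1 hτ]; rfl
  T_norm_one y τ hτ := by rw [Set.mem_singleton_iff.1 hτ]; simp
  pt := mk p
  frobY := frobPt p
  pt_frob _ := rfl
  galF _ := RingHom.id _
  absF_galF _ _ := rfl
  galY _ := id
  pt_gal _ _ := rfl
  abs0 := Model.absOne p
  abs0_p := by rw [Model.absOne_apply]; exact norm_p_pos_lt_one p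
  emb _ := RingHom.id _
  scale y := ExpModel.sc (e p y)
  scale_pos y := ExpModel.sc_pos _
  absK_emb y z := by
    show ‖z‖ ^ ExpModel.sc (e p y) = (Model.absOne p z) ^ ExpModel.sc (e p y)
    rw [Model.absOne_apply]
  absK_pt a ha0 ha1 := by
    show ‖(p : PadicAlgCl p)‖ ^ ExpModel.sc (e p (mk p a)) = Model.absOne p a
    rw [Model.absOne_apply] at ha1 ⊢
    rw [e_mk]
    exact norm_p_rpow_sc p ⟨norm_pos_iff.2 ha0, ha1⟩

/-- **The joint-model prototype datum**: `ℓ⋆ = 2`, `q_E := p^{10}`, `ξ := p` (as in the exponent model). [folklore] -/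
def prototypeDatum :
    PrototypeDatum (PadicAlgCl p) (Pt p → PadicAlgCl p) (PadicAlgCl p) (Pt p) (fun _ => PadicAlgCl p) Unit where
  toPeriodRingDatum := periodRingDatum p
  lstar := 2
  one_le_lstar := by norm_num
  q := (p : PadicAlgCl p) ^ 10
  abs0_q := by
    show 0 < Model.absOne p _ ∧ Model.absOne p _ < 1
    rw [Model.absOne_apply, norm_pow]
    exact ⟨pow_pos (norm_p_pos_lt_one p).1 _, pow_lt_one₀ (norm_nonneg _) (norm_p_pos_lt_one p).2 (by norm_num)⟩
  xi := p
  abs0_xi := by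
    show Model.absOne p (p : PadicAlgCl p) = (Model.absOne p ((p : PadicAlgCl p) ^ 10)) ^ (1 / (2 * ((2 * 2 + 1 : ℕ) : ℝ)))
    rw [Model.absOne_apply, Model.absOne_apply, norm_pow]
    have h : (1 / (2 * ((2 * 2 + 1 : ℕ) : ℝ))) = ((10 : ℕ) : ℝ)⁻¹ := by norm_num
    rw [h, Real.pow_rpow_inv_natCast (norm_nonneg _) (by norm_num)]

/-- **The point-Frobenius of the joint model is a BIJECTION.** [folklore] -/
theorem frobY_bijective : Function.Bijective (prototypeDatum p).frobY := frobPt_bijective p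

/-- **`p`-th roots exist in the joint model's tilt** (`Q̄_p`). [folklore] -/
theorem exists_pth_root (b : PadicAlgCl p) : ∃ a : PadicAlgCl p, a ^ (prototypeDatum p).p = b :=
  IsAlgClosed.exists_pow_nat_eq b hp.out.pos

/-- **E-t2's `EtaPtTeich` HOLDS in the joint model**: `η_{K_{y_a}}([a]) = [a]([a]) = p` for `0 ≠ a`, `|a|_F < 1`. [folklore] -/
theorem etaPtTeich : (prototypeDatum p).EtaPtTeich := by
  intro a ha0 ha1
  show teichAt p (mk p a) a = (p : PadicAlgCl p)
  exact teichAt_mk_self p ⟨norm_pos_iff.2 ha0, by rwa [show (prototypeDatum p).absF = Model.absOne p from rfl,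
    Model.absOne_apply] at ha1⟩

/-- **PACKAGED**: `EtaPtTeich` AND a bijective point-Frobenius at ONE datum over E-t3's signature. [folklore] -/
theorem etaPtTeich_and_frobY_bijective :
    (prototypeDatum p).EtaPtTeich ∧ Function.Bijective (prototypeDatum p).frobY := ⟨etaPtTeich p, frobY_bijective p⟩

end Summit.ABC.IUTFork.Joshi.JointModel

end
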